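import Literature.Analysis.FluidPDE.Tao2016AveragedNS.SeedScaleClosure
import HarnessLib

/-!
# The exponent `q = 5` off the top corner of the sharpness range

Cell `pub-fluidc`, blueprint seat 1 (gen 14). HONEST FRAMING: low prior, high value-of-information
experiment on Tao's machine paradigm [Tao2016AveragedNS, §5.5]; NOT a claim that NS blows up.

The cell's seed-scale question `PseudoOrbitTransitionSeed q` (budget `δ₀ + δT ≤ ε²e^{-M}/K^q`,
uniformly over the sharpness range `3000 log K ≤ M ≤ K¹⁰`) is NO for `q ≤ 4` and YES for `q ≥ 6`
(`pseudoOrbitTransitionSeed_iff_of_ne_five`, SeedScaleClosure.lean). This file locates what is left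
of `q = 5`: Theorem 5.3 along pseudo-orbits (`IsPseudoOrbit.fired_from_two`) needs
`δ₀ + δT < ε²e^{-M}/(8√M)`, and `ε²e^{-M}/K⁵ < ε²e^{-M}/(8√M)` iff `8√M < K⁵` iff `64M < K¹⁰`.
Hence the `q = 5` statement HOLDS for every member off the top corner `K¹⁰/64 ≤ M ≤ K¹⁰` of the
range (`pseudoOrbitTransitionSeed_five_off_corner`); only that corner — where the `q = 5` budget
`ε²e^{-M}K⁻⁵` lies between the firing budget `ε²e^{-M}/(8√M) ∈ [ε²e^{-M}K⁻⁵/8, ε²e^{-M}K⁻⁵]` and the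
stall threshold `2ε²e^{-M}/√M ∈ [2ε²e^{-M}K⁻⁵, 16ε²e^{-M}K⁻⁵]` of the negative-kick dud — is undecided.

* `seedBudget_five_lt` — `64M < K¹⁰ ⇒ ε²e^{-M}/K⁵ < ε²e^{-M}/(8√M)`;
* `IsPseudoOrbit.fired_from_two_five` — fired on `[2,T]` under the `q = 5` budget off the corner;
* `pseudoOrbitTransitionSeed_five_off_corner` — the `q = 5` statement with `M ≤ K¹⁰` replaced by
  `64M < K¹⁰`.
-/

namespace Literature.Analysis.FluidPDE.Tao2016AveragedNS

open Real Set
open scoped NNReal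

/-- Off the corner, `64M < K¹⁰` gives `8√M < K⁵` and the `q = 5` budget is strictly inside the
chain's budget `ε²e^{-M}/(8√M)`. [folklore] -/
theorem seedBudget_five_lt {K M ε : ℝ} (hK : 0 ≤ K) (hM : 0 < M) (hcorner : 64 * M < K ^ 10)
    (hε : 0 < ε) : ε ^ 2 * exp (-M) / K ^ 5 < ε ^ 2 * exp (-M) / (8 * Real.sqrt M) := by
  have h64 : Real.sqrt 64 = 8 := by
    rw [show (64 : ℝ) = 8 ^ 2 by norm_num, Real.sqrt_sq (by norm_num)]
  have h8 : 8 * Real.sqrt M < K ^ 5 := by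
    calc 8 * Real.sqrt M = Real.sqrt (64 * M) := by rw [Real.sqrt_mul (by norm_num), h64]
      _ < Real.sqrt (K ^ 10) := Real.sqrt_lt_sqrt (by positivity) hcorner
      _ = K ^ 5 := by rw [show K ^ 10 = (K ^ 5) ^ 2 by ring, Real.sqrt_sq (by positivity)]
  have hsM : 0 < Real.sqrt M := Real.sqrt_pos.2 hM
  exact div_lt_div_of_pos_left (by positivity) (by positivity) h8

section Member

variable {K M ε δ δ₀ T : ℝ} {Y : ℝ → Fin 5 → ℝ}

/-- **Theorem 5.3 along pseudo-orbits under the `q = 5` budget, off the corner.** For a member with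
`64M < K¹⁰`, every `δ`-pseudo-orbit in the sup-ball of radius `2` on `[0,T]` (`T ≥ 2`) issued
`δ₀`-close to (5.6) with `δ₀ + δT ≤ ε²e^{-M}/K⁵` is fired on `[2,T]`: `|ã - 1| ≤ 6K⁻²⁰`, modes
`≤ 4K⁻¹⁰`. [cite: Tao2016AveragedNS, §5.5 Theorem 5.3] -/
theorem IsPseudoOrbit.fired_from_two_five (hY : IsPseudoOrbit (delayCircuitWith K M ε) δ 2 T Y)
    (hK : 2 * 20 ^ 42 * (Nat.factorial 42 : ℝ) + 16 ≤ K) (hML : 3000 * Real.log K ≤ M)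
    (hcorner : 64 * M < K ^ 10) (hε : 0 < ε) (hεle : ε ≤ exp (-(10 * M)) / K ^ 100) (hT : 2 ≤ T)
    (h0 : ‖Y 0 - delayInit‖ ≤ δ₀) (hB : δ₀ + δ * T ≤ ε ^ 2 * exp (-M) / K ^ 5) :
    ∀ t ∈ Icc 2 T, |Y t 4 - 1| ≤ 6 / K ^ 20 ∧ ∀ i : Fin 5, i ≠ 4 → |Y t i| ≤ 4 / K ^ 10 := by
  have hpos : (0 : ℝ) ≤ 2 * 20 ^ 42 * (Nat.factorial 42 : ℝ) := by positivity
  have hK16 : (16 : ℝ) ≤ K := by linarith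
  have hK10 : (0 : ℝ) ≤ K ^ 10 := by positivity
  have hMK : M ≤ K ^ 10 := by
    rcases le_or_gt 0 M with hM | hM
    · linarith
    · linarith
  obtain ⟨-, hM4, -, -, -, -⟩ := negKick_params hK hML hMK hε hεle
  exact hY.fired_from_two hK hML hMK hε hεle hT h0
    (hB.trans_lt (seedBudget_five_lt (by linarith) (by linarith) hcorner hε))

end Member

/-- **`q = 5` off the corner.** The cell's seed-scale statement at `q = 5` with the range condition
`M ≤ K¹⁰` strengthened to `64M < K¹⁰`: TRUE. What remains undecided of `PseudoOrbitTransitionSeed 5`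
is the corner `K¹⁰/64 ≤ M ≤ K¹⁰`. [cite: Tao2016AveragedNS, §5.5 Theorem 5.3] -/
theorem pseudoOrbitTransitionSeed_five_off_corner :
    ∀ (K M ε δ δ₀ T : ℝ) (Y : ℝ → Fin 5 → ℝ),
      2 * 20 ^ 42 * (Nat.factorial 42 : ℝ) + 16 ≤ K → 3000 * Real.log K ≤ M → 64 * M < K ^ 10 →
      0 < ε → ε ≤ Real.exp (-(10 * M)) / K ^ 100 → 2 ≤ T → 0 ≤ δ₀ → 0 ≤ δ →
      IsPseudoOrbit (delayCircuitWith K M ε) δ 2 T Y → ‖Y 0 - delayInit‖ ≤ δ₀ →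
      δ₀ + δ * T ≤ ε ^ 2 * Real.exp (-M) / K ^ 5 →
      ∀ t ∈ Icc 2 T, |Y t 4 - 1| ≤ 1 / 4 ∧ ∀ i : Fin 5, i ≠ 4 → |Y t i| ≤ 1 / 4 := by
  intro K M ε δ δ₀ T Y hK hML hcorner hε hεle hT hδ₀ hδ hY h0 hB t ht
  have hpos : (0 : ℝ) ≤ 2 * 20 ^ 42 * (Nat.factorial 42 : ℝ) := by positivity
  have hK16 : (16 : ℝ) ≤ K := by linarith
  have hK1 : (1 : ℝ) ≤ K := by linarith
  have h20 : (256 : ℝ) ≤ K ^ 20 :=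
    le_trans (by nlinarith) (pow_le_pow_right₀ hK1 (by norm_num : 2 ≤ 20))
  have h10 : (16 : ℝ) ≤ K ^ 10 := le_trans hK16 (le_self_pow₀ hK1 (by norm_num))
  have h6 : (6 : ℝ) / K ^ 20 ≤ 1 / 4 := by rw [div_le_iff₀ (by positivity)]; linarith
  have h4 : (4 : ℝ) / K ^ 10 ≤ 1 / 4 := by rw [div_le_iff₀ (by positivity)]; linarith
  obtain ⟨he, hi⟩ := hY.fired_from_two_five hK hML hcorner hε hεle hT h0 hB t ht
  exact ⟨he.trans h6, fun i hi' => (hi i hi').trans h4⟩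

end Literature.Analysis.FluidPDE.Tao2016AveragedNS
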